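import Summits.BirchSwinnertonDyer.BirchSwinnertonDyer.Theorems.KolyvaginDepthDoorKNSupplyExactReadingDepthRow
import Literature.NumberTheory.EllipticCurves.HeegnerPointsKolyvaginLevelOneStructure
import HarnessLib

/-!
# Route `KolyvaginDepthDoor`, crux `KolyvaginDepthSupplyKN` (stmt-BirchSwinnertonDyer-22820) —
# THE EXACT READING ON W. ZHANG'S ♠ CELL (any `p ∤ d_K·N`, inert OR split, `d_K` of either parity):
# the same two-sided readings with the supply from W. Zhang 2014 Lemma 8.4 (1) / Thm. 9.1 BY NAME
# instead of Castella–Sano's split case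

Helper file of the lead prover of line `levelone` (kdd-p1 g14; `--supports stmt-BirchSwinnertonDyer-22820
--as helper`); it closes nothing and BSD is not proved by it.

The exact readings of `KolyvaginDepthDoorKNSupplyExactReading{,DepthRow}` take their supply half from
Castella–Sano 2026 Thm. 3, whose unconditional case is `p` SPLIT in `K` (and `d_K` odd). Of the 18
rank-2 depth-table rows only 4 have `p` split; the other 14 have `p` INERT. On W. Zhang's Hypothesis-♠
cell (♠ (1): `p ∤ v_ℓ(Δ_min)` at every `ℓ ∥ N`; ♠ (2): `N` square-free, or two distinct multiplicative
primes one of which is in `Ram(ρ̄)`) the supply is W. Zhang 2014 Lemma 8.4 (1) + Thm. 9.1 BY NAME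
(`WZhang2014_lemma84_exists_minimal_kolyvaginClass_one_selmerCard`, g11's Literature record p659238,
which carries BOTH halves of the dichotomy and needs only `p ∤ d_K`, `(d_K, N) = 1`, Heegner — NO
splitting or parity condition on `K`). Hence, for the 15 square-free-conductor curves of the table (all
but `664a1`, `916c1`, `944e1`), every row — inert or split — is two-sided and un-pinned modulo (γ) +
Zhang's fact:

* `kolyvaginClass_rankClause_iff_shaTrivial_twistCondition_of_lemma84` — the exact reading of the
  crux body (all ranks, signed clause) on the ♠ cell.
* `kolyvaginClass_depth_ne_zero_iff_shaTrivial_twistSelmer_of_lemma84` — the row at depth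
  `rank E − 1`: «bit» `↔` «`Ш(E)[p] = 0` ∧ `#Sel_p(E^{(d_K)}) ≤ p^{rank E − 1}`».
* `kolyvaginClass_prime_ne_zero_iff_shaTrivial_twistSelmer_of_rank_two_of_lemma84` — the rank-2 row:
  «∃ ℓ: `c_1(ℓ) ≠ 0`» `↔` «`Ш(E)[p] = 0` ∧ `#Sel_p(E^{(d_K)}) ≤ p`» (supersedes g11's pinned
  `kolyvaginClass_one_prime_ne_zero_iff_sha_trivial_of_rank_two`, p660626).

Both Kodaira–Néron currencies appear as hypotheses (`ordMinimalDiscriminant` at places for the door,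
`padicValInt ℓ Δ_min` at primes for Zhang's ♠ (1)); they coincide, the bridge is bookkeeping.
CONDITIONAL on (γ) and the Zhang fact; per `(E, p, K)`; BSD is NOT proved by any of this.

References: [WZhang2014] Lemma 8.4 (1) (p. 236), Thm. 9.1 (p. 240), Hypothesis ♠ (p. 195);
[GrossLMS1991] Prop. 3.7 (2), §5 (5.1); [Kolyvagin1991MathAnn] Thm. 2.3; [SilvermanAEC2009] Thm. X.4.2.
-/

set_option linter.dupNamespace false

noncomputable section

open scoped Classical NumberField

namespace Summit.BirchSwinnertonDyer.BirchSwinnertonDyer.Theorems.KolyvaginDepthDoor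

open Literature.NumberTheory.EllipticCurves Literature.NumberTheory.EllipticCurves.ModularForms
  WeierstrassCurve NumberField IsDedekindDomain
open Summit.BirchSwinnertonDyer.BirchSwinnertonDyer.Theorems

/-- A square-free natural number with exactly one prime factor is prime. [folklore] -/
private theorem prime_of_squarefree_of_card_primeFactors_eq_one₁₄' {n : ℕ} (hsq : Squarefree n)
    (h1 : n.primeFactors.card = 1) : n.Prime := by
  obtain ⟨ℓ, hℓ⟩ := Finset.card_eq_one.mp h1
  have hprod := Nat.prod_primeFactors_of_squarefree hsq
  rw [hℓ, Finset.prod_singleton] at hprod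
  have hmem : ℓ ∈ n.primeFactors := by rw [hℓ]; exact Finset.mem_singleton_self ℓ
  rw [← hprod]
  exact Nat.prime_of_mem_primeFactors hmem

/-- **Door of the row at depth `rank E − 1` ((γ) only; no supply fact).** `E/ℚ` non-CM globally
minimal, `K` imaginary quadratic Heegner (`d_K ≠ −3, −4`), `p ≥ 5` with `ρ_{E,p^n}` onto for all `n` and
`p ∤ ord_v(Δ_min)` at multiplicative `v`: a datum of square-free conductor `n₁` with `ν(n₁) + 1 = rank E`
and `c_1(n₁) ≠ 0` gives `Ш(E/ℚ)[p] = 0` and `#Sel_p(E^{(d_K)}/ℚ) ≤ p^{rank E − 1}` (first-sign door of a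
datum + Kolyvagin's second eigen-bound read on the twist). CONDITIONAL on (γ) only; per curve.
[cite: Kolyvagin1991MathAnn, Thm. 2.3] [cite: GrossLMS1991, Prop. 3.7 (2), §5 (5.1)] -/
theorem shaTrivial_twistSelmer_of_kolyvaginClass_depth_ne_zero
    (h372 : GrossLMS1991.prop37_2_frobeniusCongruence)
    (W : WeierstrassCurve ℚ) [W.IsElliptic] [W.IsGloballyMinimal] (hcm : ¬ W.HasCM)
    (p : ℕ) [hp : Fact p.Prime] (h5 : 5 ≤ p)
    (htower : ∀ n : ℕ, W.HasSurjectiveModNGaloisRep (p ^ n : ℕ))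
    (hKN : ∀ v : HeightOneSpectrum (𝓞 ℚ), W.HasMultiplicativeReductionAt v →
      ¬ p ∣ W.ordMinimalDiscriminant v)
    (K : Type) [Field K] [NumberField K] (hK : IsImaginaryQuadratic K)
    (hD3 : NumberField.discr K ≠ -3) (hD4 : NumberField.discr K ≠ -4)
    [NeZero (W.conductorNorm ℤ)] (hH : SatisfiesHeegnerHypothesis (W.conductorNorm ℤ) K)
    {Dt : ModularParametrizationData W (W.conductorNorm ℤ)} {β : ℤ} {ι : K →+* ℂ} {n₁ : ℕ}
    (hn₁ : Squarefree n₁)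
    (hk₁ : ∀ q ∈ n₁.primeFactors, Zhang2014.IsKolyvaginPrime (W.conductorNorm ℤ) W K p q)
    (hν : n₁.primeFactors.card + 1 = W.mordellWeilRank)
    (d : KolyvaginHeegnerData Dt β ι n₁) (hne : d.kolyvaginClass hp.out 1 ≠ 0) :
    (W.sha ⊓ AddSubgroup.torsionBy W.galH1 (p : ℤ) : AddSubgroup W.galH1) = ⊥ ∧
      Nat.card ((W.quadraticTwist (NumberField.discr K : ℚ)).selmerGroup p) ≤
        p ^ (W.mordellWeilRank - 1) := by
  have hp2 : p ≠ 2 := by omega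
  have hadd : ∀ v : HeightOneSpectrum (𝓞 ℚ), W.HasAdditiveReductionAt v → p ≠ 3 ∨
      (W.kodairaSymbolAt v ≠ Literature.NumberTheory.DiophantineGeometry.KodairaSymbol.IV ∧
        W.kodairaSymbolAt v ≠ Literature.NumberTheory.DiophantineGeometry.KodairaSymbol.IVstar) :=
    fun _ _ ↦ Or.inl (by omega)
  obtain ⟨c, hc, hcc⟩ := exists_conj_of_isImaginaryQuadratic K hK
  obtain ⟨-, -, -, -, hbot, -⟩ :=
    shaCorank_eq_zero_of_kolyvaginClass_ne_zero_of_rank_le_of_datum_kodairaNeron h372 hcm hK hD3 hD4 hH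
      p hp2 htower c hc hcc hKN hadd hn₁ hk₁ d hne hν.le
  obtain ⟨-, hSelT, -⟩ :=
    natCard_selmerGroup_twist_le_of_kolyvaginClass_ne_zero_of_datum_kodairaNeron h372 hcm hK hD3 hD4 hH
      p hp2 htower c hc hcc hKN hadd hn₁ hk₁ d hne hν.le
  refine ⟨by simpa only [pow_one] using hbot, ?_⟩
  have hνr : W.mordellWeilRank - 1 = n₁.primeFactors.card := by omega
  rw [hνr]
  rw [pow_one] at hSelT
  exact hSelT


/-- **THE EXACT READING ON THE ♠ CELL (modulo (γ) and W. Zhang's Lemma 8.4 (1) / Thm. 9.1 by name;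
any `p ∤ d_K`, inert or split).** Hypotheses: `E/ℚ` non-CM globally minimal; `p ≥ 5` good ordinary, tower
onto, Kodaira–Néron in both currencies, ♠ (2); `K` imaginary quadratic Heegner, `d_K ≠ −3, −4`,
`p ∤ d_K`. THEN «∃ frame, `n₁ ∈ Λ`, datum: `c_1(n₁) ≠ 0` ∧ signed clause» `↔` «`Ш(E/ℚ)[p] = 0` ∧
(`#Sel_p(E^{(d_K)}) ≤ p^{rank E}` ∨ (`Ш(E^{(d_K)})[p] = 0` ∧ `rank E^{(d_K)} = rank E + 1`))». `→`: the
doors ((γ) only); `←`: Zhang's fact (both halves of the dichotomy) and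
`rankClause_of_structure_of_twistCondition`. CONDITIONAL on the two named facts; per curve; BSD is not
proved by it. [cite: WZhang2014, Lemma 8.4 (1) (p. 236), Thm. 9.1 (p. 240)] [cite: GrossLMS1991, Prop. 3.7 (2)]
[cite: SilvermanAEC2009, Thm. X.4.2] -/
theorem kolyvaginClass_rankClause_iff_shaTrivial_twistCondition_of_lemma84
    (h372 : GrossLMS1991.prop37_2_frobeniusCongruence)
    (h84 : Literature.NumberTheory.EllipticCurves.WZhang2014_lemma84_exists_minimal_kolyvaginClass_one_selmerCard)
    (W : WeierstrassCurve ℚ) [W.IsElliptic] [W.IsGloballyMinimal] (hcm : ¬ W.HasCM)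
    (p : ℕ) [hp : Fact p.Prime] (h5 : 5 ≤ p) (hgood : W.HasGoodReductionAtPrime p)
    (hord : ¬ (p : ℤ) ∣ W.frobeniusTrace p)
    (htower : ∀ n : ℕ, W.HasSurjectiveModNGaloisRep (p ^ n : ℕ))
    (hKN : ∀ v : HeightOneSpectrum (𝓞 ℚ), W.HasMultiplicativeReductionAt v →
      ¬ p ∣ W.ordMinimalDiscriminant v)
    (hS1 : ∀ (ℓ : ℕ) [Fact ℓ.Prime], W.HasMultiplicativeReductionAtPrime ℓ →
      ¬ p ∣ padicValInt ℓ W.minimalDiscriminantInt)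
    (hS2 : ¬ Squarefree (W.conductorNorm ℤ) →
      (∃ (ℓ : ℕ) (_ : Fact ℓ.Prime), W.HasMultiplicativeReductionAtPrime ℓ ∧
          ¬ p ∣ padicValInt ℓ W.minimalDiscriminantInt) ∧
        ∃ (ℓ₁ ℓ₂ : ℕ) (_ : Fact ℓ₁.Prime) (_ : Fact ℓ₂.Prime), ℓ₁ ≠ ℓ₂ ∧
          W.HasMultiplicativeReductionAtPrime ℓ₁ ∧ W.HasMultiplicativeReductionAtPrime ℓ₂)
    (K : Type) [Field K] [NumberField K] (hK : IsImaginaryQuadratic K)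
    (hD3 : NumberField.discr K ≠ -3) (hD4 : NumberField.discr K ≠ -4)
    (hpD : ¬ ((p : ℤ) ∣ NumberField.discr K))
    [NeZero (W.conductorNorm ℤ)] (hH : SatisfiesHeegnerHypothesis (W.conductorNorm ℤ) K) :
    (∃ (Dt : ModularParametrizationData W (W.conductorNorm ℤ)) (β : ℤ) (ι : K →+* ℂ) (n₁ : ℕ)
      (d : KolyvaginHeegnerData Dt β ι n₁), Squarefree n₁ ∧
        (∀ q ∈ n₁.primeFactors, Zhang2014.IsKolyvaginPrime (W.conductorNorm ℤ) W K p q) ∧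
        d.kolyvaginClass hp.out 1 ≠ 0 ∧
        (n₁.primeFactors.card + 1 ≤ W.mordellWeilRank ∨
          (n₁.primeFactors.card ≤ W.mordellWeilRank ∧
            n₁.primeFactors.card + 1 ≤ (W.quadraticTwist (NumberField.discr K : ℚ)).mordellWeilRank))) ↔
    ((W.sha ⊓ AddSubgroup.torsionBy W.galH1 (p : ℤ) : AddSubgroup W.galH1) = ⊥ ∧
      (Nat.card ((W.quadraticTwist (NumberField.discr K : ℚ)).selmerGroup p) ≤ p ^ W.mordellWeilRank ∨
        (((W.quadraticTwist (NumberField.discr K : ℚ)).sha ⊓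
            AddSubgroup.torsionBy (W.quadraticTwist (NumberField.discr K : ℚ)).galH1 (p : ℤ) :
            AddSubgroup (W.quadraticTwist (NumberField.discr K : ℚ)).galH1) = ⊥ ∧
          (W.quadraticTwist (NumberField.discr K : ℚ)).mordellWeilRank = W.mordellWeilRank + 1))) := by
  constructor
  · exact shaTrivial_twistCondition_of_kolyvaginClass_rankClause_kodairaNeron h372 W hcm p h5 htower hKN
      K hK hD3 hD4 hH
  · rintro ⟨hshaW, hTC⟩
    have hsur : W.HasSurjectiveModNGaloisRep p := by simpa only [pow_one] using htower 1
    have hDN : IsCoprime (NumberField.discr K) ((W.conductorNorm ℤ : ℕ) : ℤ) := by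
      rw [Int.isCoprime_iff_gcd_eq_one, Int.gcd_comm]
      exact Literature.SatisfiesHeegnerHypothesis.coprime_discr hK.1 hH
    obtain ⟨Dt, β, ι, n, d, hsupp, -, hne, -, hdich⟩ :=
      h84 W p h5 hgood hord hsur hS1 hS2 K hK hpD hDN hH
    obtain ⟨Dt', β', ι', n', d', hsupp', hne', hclause⟩ :=
      rankClause_of_structure_of_twistCondition W p hsur K ⟨Dt, β, ι, n, d, hsupp, hne, hdich⟩ hshaW hTC
    exact ⟨Dt', β', ι', n', d', hsupp'.1, hsupp'.2, hne', hclause⟩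

/-- **THE DEPTH-TABLE ROW ON THE ♠ CELL, any rank `r ≥ 1`, inert or split (modulo (γ) and Zhang's
fact).** «∃ frame, square-free product `n₁` of `r − 1` Kolyvagin primes, datum: `c_1(n₁) ≠ 0`» `↔`
«`Ш(E/ℚ)[p] = 0` ∧ `#Sel_p(E^{(d_K)}/ℚ) ≤ p^{r−1}`». CONDITIONAL on the two named facts; per curve; BSD
is not proved by it. [cite: WZhang2014, Lemma 8.4 (1) (p. 236)] [cite: GrossLMS1991, Prop. 3.7 (2), §5 (5.1)]
[cite: Kolyvagin1991MathAnn, Thm. 2.3] -/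
theorem kolyvaginClass_depth_ne_zero_iff_shaTrivial_twistSelmer_of_lemma84
    (h372 : GrossLMS1991.prop37_2_frobeniusCongruence)
    (h84 : Literature.NumberTheory.EllipticCurves.WZhang2014_lemma84_exists_minimal_kolyvaginClass_one_selmerCard)
    (W : WeierstrassCurve ℚ) [W.IsElliptic] [W.IsGloballyMinimal] (hcm : ¬ W.HasCM)
    (p : ℕ) [hp : Fact p.Prime] (h5 : 5 ≤ p) (hgood : W.HasGoodReductionAtPrime p)
    (hord : ¬ (p : ℤ) ∣ W.frobeniusTrace p)
    (htower : ∀ n : ℕ, W.HasSurjectiveModNGaloisRep (p ^ n : ℕ))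
    (hKN : ∀ v : HeightOneSpectrum (𝓞 ℚ), W.HasMultiplicativeReductionAt v →
      ¬ p ∣ W.ordMinimalDiscriminant v)
    (hS1 : ∀ (ℓ : ℕ) [Fact ℓ.Prime], W.HasMultiplicativeReductionAtPrime ℓ →
      ¬ p ∣ padicValInt ℓ W.minimalDiscriminantInt)
    (hS2 : ¬ Squarefree (W.conductorNorm ℤ) →
      (∃ (ℓ : ℕ) (_ : Fact ℓ.Prime), W.HasMultiplicativeReductionAtPrime ℓ ∧
          ¬ p ∣ padicValInt ℓ W.minimalDiscriminantInt) ∧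
        ∃ (ℓ₁ ℓ₂ : ℕ) (_ : Fact ℓ₁.Prime) (_ : Fact ℓ₂.Prime), ℓ₁ ≠ ℓ₂ ∧
          W.HasMultiplicativeReductionAtPrime ℓ₁ ∧ W.HasMultiplicativeReductionAtPrime ℓ₂)
    (K : Type) [Field K] [NumberField K] (hK : IsImaginaryQuadratic K)
    (hD3 : NumberField.discr K ≠ -3) (hD4 : NumberField.discr K ≠ -4)
    (hpD : ¬ ((p : ℤ) ∣ NumberField.discr K))
    [NeZero (W.conductorNorm ℤ)] (hH : SatisfiesHeegnerHypothesis (W.conductorNorm ℤ) K)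
    (hr : 1 ≤ W.mordellWeilRank) :
    (∃ (Dt : ModularParametrizationData W (W.conductorNorm ℤ)) (β : ℤ) (ι : K →+* ℂ) (n₁ : ℕ)
      (d : KolyvaginHeegnerData Dt β ι n₁), Squarefree n₁ ∧
        (∀ q ∈ n₁.primeFactors, Zhang2014.IsKolyvaginPrime (W.conductorNorm ℤ) W K p q) ∧
        n₁.primeFactors.card + 1 = W.mordellWeilRank ∧ d.kolyvaginClass hp.out 1 ≠ 0) ↔
    ((W.sha ⊓ AddSubgroup.torsionBy W.galH1 (p : ℤ) : AddSubgroup W.galH1) = ⊥ ∧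
      Nat.card ((W.quadraticTwist (NumberField.discr K : ℚ)).selmerGroup p) ≤
        p ^ (W.mordellWeilRank - 1)) := by
  have hpP : p.Prime := hp.out
  have h1p : 1 < p := hpP.one_lt
  have h2p : 2 ≤ p := hpP.two_le
  have hsur : W.HasSurjectiveModNGaloisRep p := by simpa only [pow_one] using htower 1
  constructor
  · rintro ⟨Dt, β, ι, n₁, d, hn₁, hk₁, hν, hne⟩
    exact shaTrivial_twistSelmer_of_kolyvaginClass_depth_ne_zero h372 W hcm p h5 htower hKN K hK hD3 hD4
      hH hn₁ hk₁ hν d hne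
  · rintro ⟨hshaW, hSelT⟩
    have hDN : IsCoprime (NumberField.discr K) ((W.conductorNorm ℤ : ℕ) : ℤ) := by
      rw [Int.isCoprime_iff_gcd_eq_one, Int.gcd_comm]
      exact Literature.SatisfiesHeegnerHypothesis.coprime_discr hK.1 hH
    obtain ⟨Dt, β, ι, n, d, hsupp, -, hne, -, hdich⟩ :=
      h84 W p h5 hgood hord hsur hS1 hS2 K hK hpD hDN hH
    have hirr : W.HasIrreducibleModPGaloisRep p :=
      hasIrreducibleModPGaloisRep_of_hasSurjectiveModNGaloisRep W p hsur
    have hSelW : Nat.card (W.selmerGroup p) = p ^ W.mordellWeilRank :=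
      natCard_selmerGroup_eq_pow_rank_of_sha_inf_torsionBy_eq_bot W p hirr hshaW
    rcases hdich with ⟨hW1, -⟩ | ⟨hT1, hWle⟩
    · rw [hSelW] at hW1
      have := Nat.pow_right_injective h2p hW1
      exact ⟨Dt, β, ι, n, d, hsupp.1, hsupp.2, by omega, hne⟩
    · exfalso
      rw [hSelW] at hWle
      have hrle := (Nat.pow_le_pow_iff_right h1p).mp hWle
      rw [hT1] at hSelT
      have hle := (Nat.pow_le_pow_iff_right h1p).mp hSelT
      omega

/-- **THE RANK-2 ROW ON THE ♠ CELL, inert or split, NO TWIST PINNING (modulo (γ) and Zhang's fact).**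
For `rank E(ℚ) = 2`: «∃ frame, Kolyvagin prime `ℓ`, datum: `c_1(ℓ) ≠ 0`» `↔` «`Ш(E/ℚ)[p] = 0` ∧
`#Sel_p(E^{(d_K)}/ℚ) ≤ p`». Supersedes g11's `kolyvaginClass_one_prime_ne_zero_iff_sha_trivial_of_rank_two`
(twist pinned). The bit at each of the 15 square-free-conductor rank-2 rows of the depth table is EXACTLY
«`Ш(E)[p] = 0` ∧ the Heegner twist's `p`-Selmer group has order `≤ p`». CONDITIONAL on the two named
facts; per curve; BSD is not proved by it. [cite: WZhang2014, Lemma 8.4 (1) (p. 236), Thm. 9.1 (p. 240)]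
[cite: GrossLMS1991, Prop. 3.7 (2)] [cite: JetchevLauterStein2009, §3.6 (arXiv:0707.0032)] -/
theorem kolyvaginClass_prime_ne_zero_iff_shaTrivial_twistSelmer_of_rank_two_of_lemma84
    (h372 : GrossLMS1991.prop37_2_frobeniusCongruence)
    (h84 : Literature.NumberTheory.EllipticCurves.WZhang2014_lemma84_exists_minimal_kolyvaginClass_one_selmerCard)
    (W : WeierstrassCurve ℚ) [W.IsElliptic] [W.IsGloballyMinimal] (hcm : ¬ W.HasCM)
    (p : ℕ) [hp : Fact p.Prime] (h5 : 5 ≤ p) (hgood : W.HasGoodReductionAtPrime p)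
    (hord : ¬ (p : ℤ) ∣ W.frobeniusTrace p)
    (htower : ∀ n : ℕ, W.HasSurjectiveModNGaloisRep (p ^ n : ℕ))
    (hKN : ∀ v : HeightOneSpectrum (𝓞 ℚ), W.HasMultiplicativeReductionAt v →
      ¬ p ∣ W.ordMinimalDiscriminant v)
    (hS1 : ∀ (ℓ : ℕ) [Fact ℓ.Prime], W.HasMultiplicativeReductionAtPrime ℓ →
      ¬ p ∣ padicValInt ℓ W.minimalDiscriminantInt)
    (hS2 : ¬ Squarefree (W.conductorNorm ℤ) →
      (∃ (ℓ : ℕ) (_ : Fact ℓ.Prime), W.HasMultiplicativeReductionAtPrime ℓ ∧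
          ¬ p ∣ padicValInt ℓ W.minimalDiscriminantInt) ∧
        ∃ (ℓ₁ ℓ₂ : ℕ) (_ : Fact ℓ₁.Prime) (_ : Fact ℓ₂.Prime), ℓ₁ ≠ ℓ₂ ∧
          W.HasMultiplicativeReductionAtPrime ℓ₁ ∧ W.HasMultiplicativeReductionAtPrime ℓ₂)
    (K : Type) [Field K] [NumberField K] (hK : IsImaginaryQuadratic K)
    (hD3 : NumberField.discr K ≠ -3) (hD4 : NumberField.discr K ≠ -4)
    (hpD : ¬ ((p : ℤ) ∣ NumberField.discr K))
    [NeZero (W.conductorNorm ℤ)] (hH : SatisfiesHeegnerHypothesis (W.conductorNorm ℤ) K)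
    (hr : W.mordellWeilRank = 2) :
    (∃ (Dt : ModularParametrizationData W (W.conductorNorm ℤ)) (β : ℤ) (ι : K →+* ℂ) (ℓ : ℕ)
      (d : KolyvaginHeegnerData Dt β ι ℓ),
      ℓ.Prime ∧ Zhang2014.IsKolyvaginPrime (W.conductorNorm ℤ) W K p ℓ ∧
        d.kolyvaginClass hp.out 1 ≠ 0) ↔
    ((W.sha ⊓ AddSubgroup.torsionBy W.galH1 (p : ℤ) : AddSubgroup W.galH1) = ⊥ ∧
      Nat.card ((W.quadraticTwist (NumberField.discr K : ℚ)).selmerGroup p) ≤ p) := by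
  have key := kolyvaginClass_depth_ne_zero_iff_shaTrivial_twistSelmer_of_lemma84 h372 h84 W hcm p h5
    hgood hord htower hKN hS1 hS2 K hK hD3 hD4 hpD hH (by omega)
  have hr1 : W.mordellWeilRank - 1 = 1 := by omega
  constructor
  · rintro ⟨Dt, β, ι, ℓ, d, hℓ, hkol, hne⟩
    have hk : ∀ q ∈ ℓ.primeFactors, Zhang2014.IsKolyvaginPrime (W.conductorNorm ℤ) W K p q := by
      intro q hq
      rw [hℓ.primeFactors, Finset.mem_singleton] at hq
      exact hq ▸ hkol
    have hν : ℓ.primeFactors.card + 1 = W.mordellWeilRank := by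
      rw [hℓ.primeFactors, Finset.card_singleton, hr]
    obtain ⟨hsha, hSel⟩ := key.mp ⟨Dt, β, ι, ℓ, d, hℓ.squarefree, hk, hν, hne⟩
    rw [hr1, pow_one] at hSel
    exact ⟨hsha, hSel⟩
  · rintro ⟨hsha, hSel⟩
    have hSel' : Nat.card ((W.quadraticTwist (NumberField.discr K : ℚ)).selmerGroup p) ≤
        p ^ (W.mordellWeilRank - 1) := by
      rw [hr1, pow_one]; exact hSel
    obtain ⟨Dt, β, ι, n₁, d, hsq, hkol, hν, hne⟩ := key.mpr ⟨hsha, hSel'⟩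
    have h1 : n₁.primeFactors.card = 1 := by omega
    have hn : n₁.Prime := prime_of_squarefree_of_card_primeFactors_eq_one₁₄' hsq h1
    have hmem : n₁ ∈ n₁.primeFactors := by
      rw [hn.primeFactors]; exact Finset.mem_singleton_self n₁
    exact ⟨Dt, β, ι, n₁, d, hn, hkol n₁ hmem, hne⟩


end Summit.BirchSwinnertonDyer.BirchSwinnertonDyer.Theorems.KolyvaginDepthDoor

end
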